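import Summits.Parity.GeneralizedHardyLittlewood.Theorems.LeeYangFibresRelativeDimOneNecessityDefs
import Mathlib.NumberTheory.Chebyshev
import Mathlib.NumberTheory.DirichletCharacter.Bounds
import HarnessLib

/-!
# Route `LeeYangFibres`, crux `RelativeDimOne` (stmt-Parity-14113), line `gallagher-backwards-split` (seat c2):
# GRH calibration of the `L`-atom — character-sum tools

Tools for `Theorems/LeeYangFibresRelativeDimOneGRHCalibration.lean` (`lowClassSecondMoment_of_grh`: GRH ⇒
`LowClassSecondMoment θ₁` for every `θ₁ < 1`). This file turns a bound for the prime counting sums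
`π(m, χ) = Σ_{p ≤ m} χ(p)` into a bound for `ψ(N, χ) = Σ_{n ≤ N} Λ(n) χ(n)` (`charPsi`):

* `sum_Ico_log_succ_sub_log` (registered hook) — the Abel weights telescope: `Σ_{1 ≤ m < n} log((m+1)/m) = log n`;
* `norm_sum_prime_log_mul_le` — **Abel summation**: `|π(m,χ)| ≤ B` for `m ≤ N` gives `|Σ_{p ≤ N} χ(p) log p| ≤ 2B log N`;
* `norm_charPsi_le` — primes by Abel summation, prime powers by `ψ(N) − ϑ(N) ≤ 2√N log N`
  (Mathlib `Chebyshev.psi_sub_theta_le`);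
* `norm_charPsi_le_of_primePi` — from the GRH-shaped bound `|π(m,χ)| ≤ C √m log(qm)` (`m ≥ 2`; the shape of
  Montgomery–Vaughan Thm. 13.7) to `|ψ(N,χ)| ≤ (4C+3) √N (log N)²` for `1 ≤ q ≤ N`, `N ≥ 2`.

References: Montgomery–Vaughan, *Multiplicative Number Theory I* (2007), §13.1 Thm. 13.7 [MontgomeryVaughan2007].
-/

noncomputable section

open scoped BigOperators ArithmeticFunction.vonMangoldt
open Finset

namespace Summit.Parity.GeneralizedHardyLittlewood.Cruxes.RelativeDimOne.GallagherBackwards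

namespace GRHCalibration

/-! ### `π(m, χ)` and Abel summation for `Σ_{p ≤ N} χ(p) log p` -/

variable {q : ℕ}

/-- `π(m, χ) = 0` for `m ≤ 1` (no primes). -/
theorem primePi_eq_zero_of_le_one (χ : DirichletCharacter ℂ q) {m : ℕ} (hm : m ≤ 1) :
    ∑ p ∈ (Iic m).filter Nat.Prime, (χ p : ℂ) = 0 := by
  refine Finset.sum_eq_zero fun p hp => ?_
  exfalso
  have h1 := (mem_filter.1 hp).2.two_le
  have h2 := mem_Iic.1 (mem_filter.1 hp).1
  omega

/-- The primes `≤ N` exceeding `m ≤ N`: `Σ_{m < p ≤ N} χ(p) = π(N, χ) − π(m, χ)`. -/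
theorem sum_filter_lt_eq (χ : DirichletCharacter ℂ q) {m N : ℕ} (hm : m ≤ N) :
    ∑ p ∈ ((Iic N).filter Nat.Prime).filter (fun p => m < p), (χ p : ℂ) = (∑ p ∈ (Iic N).filter Nat.Prime, (χ p : ℂ)) - (∑ p ∈ (Iic m).filter Nat.Prime, (χ p : ℂ)) := by
  have hsplit := sum_filter_add_sum_filter_not ((Iic N).filter Nat.Prime) (fun p => m < p) (fun p => (χ p : ℂ))
  have hle : ∑ p ∈ ((Iic N).filter Nat.Prime).filter (fun p => ¬ m < p), (χ p : ℂ) = (∑ p ∈ (Iic m).filter Nat.Prime, (χ p : ℂ)) := by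
    refine Finset.sum_congr ?_ fun _ _ => rfl
    ext p
    simp only [mem_filter, mem_Iic, not_lt]
    constructor
    · rintro ⟨⟨-, hp⟩, hpm⟩
      exact ⟨hpm, hp⟩
    · rintro ⟨hpm, hp⟩
      exact ⟨⟨hpm.trans hm, hp⟩, hpm⟩
  rw [hle] at hsplit
  linear_combination hsplit

/-- Telescoping: `Σ_{1 ≤ m < n} (log(m+1) − log m) = log n`. -/
theorem sum_Ico_log_succ_sub_log :
    ∀ n : ℕ, 1 ≤ n → ∑ m ∈ Finset.Ico 1 n, (Real.log ((m : ℝ) + 1) - Real.log m) = Real.log n := by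
  intro n hn
  have htel : ∑ m ∈ range n, (Real.log ((m : ℝ) + 1) - Real.log m) = Real.log n - Real.log ((0 : ℕ) : ℝ) := by
    have := Finset.sum_range_sub (fun m : ℕ => Real.log (m : ℝ)) n
    simpa [Nat.cast_succ] using this
  rw [Nat.cast_zero, Real.log_zero, sub_zero] at htel
  rw [← htel, Finset.range_eq_Ico, Finset.sum_eq_sum_Ico_succ_bot (show 0 < n by omega)]
  simp

/-- **Abel summation**: if `‖π(m, χ)‖ ≤ B` for `1 ≤ m ≤ N`, then `‖Σ_{p ≤ N} χ(p) log p‖ ≤ 2 B log N`. -/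
theorem norm_sum_prime_log_mul_le (χ : DirichletCharacter ℂ q) {N : ℕ} (hN : 1 ≤ N) {B : ℝ}
    (hB : ∀ m : ℕ, 1 ≤ m → m ≤ N → ‖(∑ p ∈ (Iic m).filter Nat.Prime, (χ p : ℂ))‖ ≤ B) :
    ‖∑ p ∈ (Iic N).filter Nat.Prime, (Real.log p : ℂ) * χ p‖ ≤ 2 * B * Real.log N := by
  set P := (Iic N).filter Nat.Prime with hP
  set d : ℕ → ℝ := fun m => Real.log ((m : ℝ) + 1) - Real.log m with hd
  have hd0 : ∀ m : ℕ, 1 ≤ m → 0 ≤ d m := by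
    intro m hm
    simp only [hd]
    have : (0 : ℝ) < m := by exact_mod_cast hm
    linarith [Real.log_le_log this (by linarith : (m : ℝ) ≤ m + 1)]
  have hB0 : 0 ≤ B := le_trans (norm_nonneg _) (hB 1 le_rfl hN)
  -- `log p = Σ_{m ∈ Ico 1 N, m < p} d m` for `p ∈ P`
  have hlog : ∀ p ∈ P, (Real.log p : ℂ) = ∑ m ∈ Ico 1 N, if m < p then (d m : ℂ) else 0 := by
    intro p hp
    have hp1 : 1 ≤ p := (mem_filter.1 hp).2.one_le
    have hpN : p ≤ N := mem_Iic.1 (mem_filter.1 hp).1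
    rw [← Finset.sum_filter]
    have hset : (Ico 1 N).filter (fun m => m < p) = Ico 1 p := by
      ext m
      simp only [mem_filter, mem_Ico]
      omega
    rw [hset, ← sum_Ico_log_succ_sub_log p hp1, Complex.ofReal_sum]
  have hS : ∑ p ∈ P, (Real.log p : ℂ) * χ p =
      ∑ m ∈ Ico 1 N, (d m : ℂ) * ∑ p ∈ P.filter (fun p => m < p), (χ p : ℂ) := by
    calc ∑ p ∈ P, (Real.log p : ℂ) * χ p
        = ∑ p ∈ P, ∑ m ∈ Ico 1 N, (if m < p then (d m : ℂ) * χ p else 0) := by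
          refine Finset.sum_congr rfl fun p hp => ?_
          rw [hlog p hp, Finset.sum_mul]
          refine Finset.sum_congr rfl fun m _ => ?_
          split_ifs <;> simp
      _ = ∑ m ∈ Ico 1 N, ∑ p ∈ P, (if m < p then (d m : ℂ) * χ p else 0) := Finset.sum_comm
      _ = ∑ m ∈ Ico 1 N, (d m : ℂ) * ∑ p ∈ P.filter (fun p => m < p), (χ p : ℂ) := by
          refine Finset.sum_congr rfl fun m _ => ?_
          rw [Finset.mul_sum, ← Finset.sum_filter]
  rw [hS]
  calc ‖∑ m ∈ Ico 1 N, (d m : ℂ) * ∑ p ∈ P.filter (fun p => m < p), (χ p : ℂ)‖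
      ≤ ∑ m ∈ Ico 1 N, ‖(d m : ℂ) * ∑ p ∈ P.filter (fun p => m < p), (χ p : ℂ)‖ := norm_sum_le _ _
    _ ≤ ∑ m ∈ Ico 1 N, d m * (2 * B) := by
        refine Finset.sum_le_sum fun m hm => ?_
        have hm1 : 1 ≤ m := (mem_Ico.1 hm).1
        have hmN : m ≤ N := (mem_Ico.1 hm).2.le
        rw [norm_mul, Complex.norm_real, Real.norm_of_nonneg (hd0 m hm1)]
        refine mul_le_mul_of_nonneg_left ?_ (hd0 m hm1)
        rw [hP, sum_filter_lt_eq χ hmN]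
        calc ‖(∑ p ∈ (Iic N).filter Nat.Prime, (χ p : ℂ)) - (∑ p ∈ (Iic m).filter Nat.Prime, (χ p : ℂ))‖ ≤ ‖(∑ p ∈ (Iic N).filter Nat.Prime, (χ p : ℂ))‖ + ‖(∑ p ∈ (Iic m).filter Nat.Prime, (χ p : ℂ))‖ := norm_sub_le _ _
          _ ≤ B + B := add_le_add (hB N hN le_rfl) (hB m hm1 hmN)
          _ = 2 * B := by ring
    _ = 2 * B * Real.log N := by
        rw [← Finset.sum_mul, sum_Ico_log_succ_sub_log N hN]
        ring

/-! ### `|ψ(N, χ)| ≤ 2B log N + 2√N log N` -/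

/-- `(Iic N).filter Prime = (Icc 1 N).filter Prime` (no prime is `0`). -/
theorem filter_prime_Iic_eq (N : ℕ) : (Iic N).filter Nat.Prime = (Icc 1 N).filter Nat.Prime := by
  ext p
  simp only [mem_filter, mem_Iic, mem_Icc]
  constructor
  · rintro ⟨h, hp⟩
    exact ⟨⟨hp.one_le, h⟩, hp⟩
  · rintro ⟨⟨-, h⟩, hp⟩
    exact ⟨h, hp⟩

/-- `ψ(N) = Σ_{1 ≤ n ≤ N} Λ(n)` (`[1, N] = (0, N]` in `ℕ`, cf. `Literature.Barriers.Parity.Icc_one_eq_Ioc_zero`). -/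
theorem psi_eq_sum_Icc (N : ℕ) : Chebyshev.psi N = ∑ n ∈ Icc 1 N, Λ n := by
  have h : Icc 1 N = Ioc 0 N := by
    ext n
    simp only [mem_Icc, mem_Ioc]
    omega
  rw [Chebyshev.psi, Nat.floor_natCast, h]

/-- The prime-power part: `Σ_{n ≤ N, n not prime} Λ(n) = ψ(N) − ϑ(N)`. -/
theorem sum_not_prime_vonMangoldt (N : ℕ) :
    ∑ n ∈ (Icc 1 N).filter (fun n => ¬ n.Prime), Λ n = Chebyshev.psi N - Chebyshev.theta N := by
  have h : Icc 1 N = Ioc 0 N := by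
    ext n
    simp only [mem_Icc, mem_Ioc]
    omega
  rw [Chebyshev.psi_sub_theta_eq_sum_not_prime, Nat.floor_natCast, h]

/-- Splitting `ψ(N, χ)` into primes (Abel summation against `π(·, χ)`) and prime powers (`ψ − ϑ`). -/
theorem norm_charPsi_le (χ : DirichletCharacter ℂ q) {N : ℕ} (hN : 1 ≤ N) {B : ℝ}
    (hB : ∀ m : ℕ, 1 ≤ m → m ≤ N → ‖(∑ p ∈ (Iic m).filter Nat.Prime, (χ p : ℂ))‖ ≤ B) :
    ‖charPsi χ N‖ ≤ 2 * B * Real.log N + 2 * Real.sqrt N * Real.log N := by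
  unfold charPsi
  rw [← sum_filter_add_sum_filter_not (Icc 1 N) Nat.Prime]
  refine (norm_add_le _ _).trans (add_le_add ?_ ?_)
  · have h : ∑ n ∈ (Icc 1 N).filter Nat.Prime, (Λ n : ℂ) * χ (n : ZMod q) =
        ∑ p ∈ (Iic N).filter Nat.Prime, (Real.log p : ℂ) * χ p := by
      rw [filter_prime_Iic_eq]
      refine sum_congr rfl fun p hp => ?_
      rw [ArithmeticFunction.vonMangoldt_apply_prime (mem_filter.1 hp).2]
    rw [h]
    exact norm_sum_prime_log_mul_le χ hN hB
  · calc ‖∑ n ∈ (Icc 1 N).filter (fun n => ¬ n.Prime), (Λ n : ℂ) * χ (n : ZMod q)‖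
        ≤ ∑ n ∈ (Icc 1 N).filter (fun n => ¬ n.Prime), ‖(Λ n : ℂ) * χ (n : ZMod q)‖ := norm_sum_le _ _
      _ ≤ ∑ n ∈ (Icc 1 N).filter (fun n => ¬ n.Prime), Λ n := by
          refine sum_le_sum fun n _ => ?_
          rw [norm_mul, Complex.norm_real, Real.norm_of_nonneg ArithmeticFunction.vonMangoldt_nonneg]
          calc Λ n * ‖χ (n : ZMod q)‖ ≤ Λ n * 1 :=
                mul_le_mul_of_nonneg_left (DirichletCharacter.norm_le_one χ _)
                  ArithmeticFunction.vonMangoldt_nonneg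
            _ = Λ n := mul_one _
      _ = Chebyshev.psi N - Chebyshev.theta N := sum_not_prime_vonMangoldt N
      _ ≤ 2 * Real.sqrt N * Real.log N := Chebyshev.psi_sub_theta_le (by exact_mod_cast hN)

/-- From a GRH-shaped bound `|π(m,χ)| ≤ C √m log(qm)` (`m ≥ 2`) to `|ψ(N,χ)| ≤ (4C+3) √N (log N)²` for
`1 ≤ q ≤ N`, `N ≥ 2`. -/
theorem norm_charPsi_le_of_primePi {C : ℝ} (hC : 0 ≤ C) (χ : DirichletCharacter ℂ q) {N : ℕ}
    (hq : 1 ≤ q) (hqN : q ≤ N) (hN : 2 ≤ N)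
    (hπ : ∀ m : ℕ, 2 ≤ m → ‖(∑ p ∈ (Iic m).filter Nat.Prime, (χ p : ℂ))‖ ≤ C * Real.sqrt m * Real.log ((q : ℝ) * m)) :
    ‖charPsi χ N‖ ≤ (4 * C + 3) * Real.sqrt N * Real.log N ^ 2 := by
  have hN1 : 1 ≤ N := by omega
  have hNr : (1 : ℝ) ≤ N := by exact_mod_cast hN1
  have hqr : (1 : ℝ) ≤ q := by exact_mod_cast hq
  have hqNr : (q : ℝ) ≤ N := by exact_mod_cast hqN
  have hlogN : 0 ≤ Real.log N := Real.log_nonneg hNr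
  have hsqN : 0 ≤ Real.sqrt N := Real.sqrt_nonneg _
  -- `log(qN) ≤ 2 log N`
  have hlogqN : Real.log ((q : ℝ) * N) ≤ 2 * Real.log N := by
    rw [Real.log_mul (by positivity) (by positivity)]
    linarith [Real.log_le_log (by positivity) hqNr]
  set B := C * Real.sqrt N * Real.log ((q : ℝ) * N) with hBdef
  have hB0 : 0 ≤ B := by
    have : 0 ≤ Real.log ((q : ℝ) * N) := Real.log_nonneg (by nlinarith)
    positivity
  have hB : ∀ m : ℕ, 1 ≤ m → m ≤ N → ‖(∑ p ∈ (Iic m).filter Nat.Prime, (χ p : ℂ))‖ ≤ B := by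
    intro m hm1 hmN
    rcases Nat.lt_or_ge m 2 with hm2 | hm2
    · rw [primePi_eq_zero_of_le_one χ (by omega), norm_zero]
      exact hB0
    · refine (hπ m hm2).trans ?_
      have hmr : (m : ℝ) ≤ N := by exact_mod_cast hmN
      have hm0 : (0 : ℝ) < m := by exact_mod_cast (show 0 < m by omega)
      have h1 : Real.sqrt m ≤ Real.sqrt N := Real.sqrt_le_sqrt hmr
      have h2 : Real.log ((q : ℝ) * m) ≤ Real.log ((q : ℝ) * N) :=
        Real.log_le_log (by positivity) (mul_le_mul_of_nonneg_left hmr (by positivity))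
      have hm2r : (2 : ℝ) ≤ m := by exact_mod_cast hm2
      have h3 : 0 ≤ Real.log ((q : ℝ) * m) := Real.log_nonneg (by nlinarith)
      rw [hBdef]
      gcongr
  have hmain := norm_charPsi_le χ hN1 hB
  have hBle : B ≤ C * Real.sqrt N * (2 * Real.log N) := by
    rw [hBdef]
    exact mul_le_mul_of_nonneg_left hlogqN (by positivity)
  calc ‖charPsi χ N‖ ≤ 2 * B * Real.log N + 2 * Real.sqrt N * Real.log N := hmain
    _ ≤ 2 * (C * Real.sqrt N * (2 * Real.log N)) * Real.log N + 2 * Real.sqrt N * Real.log N := by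
        gcongr
    _ = 4 * C * Real.sqrt N * Real.log N ^ 2 + 2 * Real.sqrt N * Real.log N := by ring
    _ ≤ 4 * C * Real.sqrt N * Real.log N ^ 2 + 3 * Real.sqrt N * Real.log N ^ 2 := by
        -- `2 log N ≤ 3 (log N)²` since `log N ≥ log 2 > 2/3`
        have h2 : Real.log 2 ≤ Real.log N := Real.log_le_log (by norm_num) (by exact_mod_cast hN)
        have := Real.log_two_gt_d9
        have hlog1 : 2 * Real.log N ≤ 3 * Real.log N ^ 2 := by nlinarith
        nlinarith [hsqN]
    _ = (4 * C + 3) * Real.sqrt N * Real.log N ^ 2 := by ring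

end GRHCalibration

end Summit.Parity.GeneralizedHardyLittlewood.Cruxes.RelativeDimOne.GallagherBackwards

end
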